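import Mathlib
import HarnessLib

/-!
# Cheng–Zhou 2016 (Math. Res. Lett. 23): generic hyperbolicity / non-degeneracy of minimal periodic orbits — the GENERICITY SHAPES of Theorems 1.1, 2.1, 3.1

CITATION HEADER (lean-in-tree rule 2026-08-18). Source: C.-Q. Cheng, M. Zhou, *Global normally hyperbolic
invariant cylinders in Lagrangian systems*, Math. Res. Lett. **23** (2016) no. 3, 685–705,
doi:10.4310/mrl.2016.v23.n3.a6 = bib key `ChengZhou2016` — REFEREED, PUBLISHED. Read in the authors' arXiv
version arXiv:1302.4889 (2013, title *Hyperbolicity of minimal periodic orbits*; materialised as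
`paper:arxiv-1302.4889`, locators `pNNNN:Lnn` = chunk:line of that text). The printed MRL text is NOT held by
the cell that wrote this file (run/shared/lean/pub/pub-arnold, acquisition request acq-07789); theorem NUMBERS
and the equations (3.1)–(3.5) quoted below are those of the arXiv version and are to be re-checked against the
print (cell claim row C30, DIVERGENCE D29).
REGULARITY THRESHOLD IN PRINT (provenance note added 2026-08-18; cell GAPS 18:15Z item 1(a)/(d), DIVERGENCE
D29′): the printed abstract (zbMATH 1381.37071: "Tonelli Lagrangian L ∈ Cʳ(T𝕋²,ℝ) with r ≥ 5") and two
refereed restatements by the first author (Cheng, Camb. J. Math. **5** (2017), Thm 2.2; Cheng, arXiv:1509.03160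
= J. Differential Geom. **106** (2017), Thm 1.3: "open-dense set … ⊂ Cʳ(𝕋²,ℝ) with r ≥ 5") state **r ≥ 5**:
the "r ≥ 4" in the quotations below is the PREPRINT's threshold and must not be read as the published one
(superseded in print for Thms 1.1/2.1; the printed threshold of Thm 3.1 is unverified until the MRL text is
held). The shapes typed in this file carry no `r`, so no declaration changes.

VERBATIM (arXiv:1302.4889).
* Theorem 1.1 (p0003:L27–28): "There exists a residual set 𝔓 ⊂ Cʳ(𝕋²,ℝ) with r ≥ 4 such that for each
  P ∈ 𝔓 and all c ∈ {ℒ_β(λg) : ∀ λ ≥ 0, ∀ g ∈ H₁(𝕋²,ℤ)}, all minimal periodic orbits of the flow determined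
  by L + P − ⟨c, ẋ⟩ are hyperbolic." Remark (p0003:L30): "The genericity proved here is in the sense of
  Mañé, the perturbation is applied only to potential."
* Theorem 2.1 (p0004:L22–23): "Given a class g ∈ H₁(𝕋²,ℤ) and a closed interval [E_a,E_d] ⊂ ℝ₊ with
  E_a > min α, there exists an open-dense set 𝔒 ⊂ Cʳ(𝕋²,ℝ) with r ≥ 4 such that for each P ∈ 𝔒, each
  E ∈ [E_a,E_d], the Mather set 𝓜̃(E,g) for L + P consists of hyperbolic periodic orbits. Indeed, except for
  finitely many E_j ∈ [E_a,E_d] where the Mather set consists of two hyperbolic periodic orbits, for all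
  other E ∈ [E_a,E_d] it consists exactly one hyperbolic periodic orbit."
* Theorem 3.1 (p0008:L55–56): "There exists an open-dense set 𝔒 ⊂ Cʳ(M,ℝ) with r ≥ 4 such that for each
  P ∈ 𝔒 and each E ∈ [E₀ − δ_{E₀}, E₀ + δ_{E₀}], all minimizers of F(·,E), determined by L + P, are
  non-degenerate." Here M = 𝕋² and F(x,E) = inf ∫₀^{2π} L̄_E is the action function of the reduced
  time-periodic system on the section (p0005:L1–9); the first-order effect of a potential P ∈ Cʳ(𝕋²) on F
  is the orbit integral (3.2) "𝒦_E P(x) = ∫₀^{2π} G(dγ(τ,x,E),τ) P(γ(τ,x,E)) dτ" (p0007:L27–35), and the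
  density argument uses the flow-adapted operator (3.3) "P(x,τ) = 𝒯_{E₀}P̄(x₀) = G_s⁻¹(v_s(x,τ),x,τ) P̄(x₀)"
  (p0008:L1–5) with the estimates (3.4)–(3.5) "|u_ℓ(x,E)| ≥ 1 − θ₁δ, |v_ℓ(x,E)| ≤ θ₁δ" (p0008:L35–43).

WHAT IS TYPED HERE, AND WHY SO LITTLE. Tonelli Lagrangians, Mather sets and hyperbolicity are not
formalised; the dynamical predicates enter as abstract fields of a data structure. What IS typed exactly is
the GENERICITY SHAPE of the three conclusions — "there is an open-dense (resp. residual) subset of the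
perturbation space all of whose members are good" — together with the shape in which such a theorem is
invoked when only a SUB-FAMILY of perturbations is admissible, i.e. when the potentials range over a
parameter space `A` mapped into the perturbation space by some `ι : A → X` (`OpenDenseGoodVia`). Two
kernel facts about that shape are recorded because they are the whole logical content of the distinction:
(1) the open-dense conclusion transfers along `ι` whenever `ι` is a continuous OPEN map
(`openDenseGoodVia_of_isOpenMap`, from Mathlib's `Dense.preimage`), e.g. along coordinate projections or
quotient maps by constants; (2) it does NOT transfer along a general continuous injection — the inclusion
of a line in the plane is a counterexample (`not_openDenseGoodVia_line`). Consequently a statement of the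
form "Theorem 2.1 for the potentials coming from `A` via `ι`", with `ι` not open, is NOT an instance of
Theorem 2.1 but a separate claim requiring that the density mechanism ((3.3)–(3.5)) be realised inside
`ι(A)`. This is exactly the form in which the theorem is used in C.-Q. Cheng, J. Xue, Sci. China Math. 66
(2023) (= arXiv:1503.04153v5, the manuscript under audit by the cell; its Lemma on the three-degree-of-
freedom subsystem says verbatim "here we are only allowed to perturb the potential of the system 𝒢_{3,δ} of
three degrees of freedom but cannot perturb 𝒢̄_{3,δ} of two degrees of freedom directly") — the cell's typed
audit focus AF5; nothing about that use is asserted in this file.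
-/

namespace Literature.Dynamics.Hamiltonian.ChengZhou2016

open Set

/-! ## Generic-property shapes -/

/-- "There is an open-dense set `O ⊆ X` all of whose members are good" — the conclusion shape of
Theorems 2.1 and 3.1 (genericity in the sense of Mañé: `X` = a space of potentials).
[cite: ChengZhou2016, Theorem 2.1 p0004:L22–23, Theorem 3.1 p0008:L55–56] -/
def OpenDenseGood (X : Type*) [TopologicalSpace X] (good : X → Prop) : Prop :=
  ∃ O : Set X, IsOpen O ∧ Dense O ∧ ∀ x ∈ O, good x

/-- "There is a residual set `R ⊆ X` all of whose members are good" — the conclusion shape of Theorem 1.1.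
[cite: ChengZhou2016, Theorem 1.1 p0003:L27–28] -/
def ResidualGood (X : Type*) [TopologicalSpace X] (good : X → Prop) : Prop :=
  ∃ R : Set X, R ∈ residual X ∧ ∀ x ∈ R, good x

/-- Open-dense genericity implies residual genericity (how Theorem 2.1 on each energy interval feeds the
countable intersection behind Theorem 1.1). [folklore] -/
theorem OpenDenseGood.residualGood {X : Type*} [TopologicalSpace X] {good : X → Prop}
    (h : OpenDenseGood X good) : ResidualGood X good := by
  obtain ⟨O, hO, hD, hg⟩ := h
  exact ⟨O, residual_of_dense_open hO hD, hg⟩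

/-- A countable family of open-dense genericity statements yields ONE residual set good for all of them
(the passage from Theorem 2.1 on countably many (class, energy-interval) pairs to Theorem 1.1). [folklore] -/
theorem residualGood_forall_of_openDenseGood {X : Type*} [TopologicalSpace X] {ι : Type*} [Countable ι]
    {good : ι → X → Prop} (h : ∀ i, OpenDenseGood X (good i)) :
    ResidualGood X (fun x => ∀ i, good i x) := by
  choose O hO hD hg using h
  refine ⟨⋂ i, O i, ?_, ?_⟩
  · exact (countable_iInter_mem).2 fun i => residual_of_dense_open (hO i) (hD i)
  · intro x hx i
    exact hg i x (Set.mem_iInter.1 hx i)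

/-- The shape in which an open-dense genericity theorem is INVOKED when only a sub-family of perturbations
is admissible: the admissible perturbations form a space `A` mapped into the perturbation space `X` by `ι`,
and genericity is asserted in `A`. With `ι = id` this is `OpenDenseGood` itself (`openDenseGoodVia_id`). [folklore] -/
def OpenDenseGoodVia (A X : Type*) [TopologicalSpace A] (ι : A → X) (good : X → Prop) : Prop :=
  OpenDenseGood A (good ∘ ι)

/-- With `ι = id` the restricted shape is the unrestricted one. [folklore] -/
theorem openDenseGoodVia_id {X : Type*} [TopologicalSpace X] {good : X → Prop} :
    OpenDenseGoodVia X X id good ↔ OpenDenseGood X good := Iff.rfl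

/-- TRANSFER along continuous OPEN maps: if `ι` is continuous and open (e.g. a coordinate projection, or
the quotient of `Cʳ(𝕋²,ℝ)` by constants), genericity in `X` pulls back to genericity in `A` (Mathlib
`Dense.preimage`). [folklore] -/
theorem openDenseGoodVia_of_isOpenMap {A X : Type*} [TopologicalSpace A] [TopologicalSpace X]
    {ι : A → X} (hc : Continuous ι) (ho : IsOpenMap ι) {good : X → Prop}
    (h : OpenDenseGood X good) : OpenDenseGoodVia A X ι good := by
  obtain ⟨O, hO, hD, hg⟩ := h
  exact ⟨ι ⁻¹' O, hO.preimage hc, hD.preimage ho, fun a ha => hg (ι a) ha⟩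

/-- NO TRANSFER in general: for the inclusion of the line `a ↦ (a, 0)` into the plane and the property
`good p := p.2 ≠ 0`, the good set is open and dense in `ℝ × ℝ` but contains NO admissible point, so the
restricted genericity statement fails. Hence "Theorem 2.1 with potentials restricted to a non-open
sub-family" is not a corollary of Theorem 2.1. [folklore] -/
theorem not_openDenseGoodVia_line :
    OpenDenseGood (ℝ × ℝ) (fun p => p.2 ≠ 0) ∧
      ¬ OpenDenseGoodVia ℝ (ℝ × ℝ) (fun a => (a, 0)) (fun p => p.2 ≠ 0) := by
  constructor
  · refine ⟨{p : ℝ × ℝ | p.2 ≠ 0}, ?_, ?_, fun p hp => hp⟩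
    · exact isOpen_ne_fun continuous_snd continuous_const
    · have h : ({p : ℝ × ℝ | p.2 ≠ 0}) = (Set.univ : Set ℝ) ×ˢ ({(0 : ℝ)}ᶜ : Set ℝ) := by
        ext p; simp
      rw [h]
      exact dense_univ.prod (dense_compl_singleton 0)
  · rintro ⟨O, -, hD, hg⟩
    obtain ⟨a, ha⟩ := hD.nonempty
    exact hg a ha rfl

/-- More generally: whenever some open dense set of `X` misses the whole image of `ι` and `A` is nonempty,
there is a property generic in `X` whose restricted version fails. (For `ι` the inclusion of a closed
subspace with empty interior — e.g. a proper closed linear subspace of a Banach space of potentials — the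
complement of the image is such a set.) [folklore] -/
theorem exists_good_not_via {A X : Type*} [TopologicalSpace A] [Nonempty A] {ι : A → X}
    [TopologicalSpace X] {O : Set X} (hO : IsOpen O) (hD : Dense O) (hmiss : ∀ a, ι a ∉ O) :
    ∃ good : X → Prop, OpenDenseGood X good ∧ ¬ OpenDenseGoodVia A X ι good := by
  refine ⟨fun x => x ∈ O, ⟨O, hO, hD, fun x hx => hx⟩, ?_⟩
  rintro ⟨O', -, hD', hg⟩
  obtain ⟨a, ha⟩ := hD'.nonempty
  exact hmiss a (hg a ha)

/-! ## Theorem shapes (schematic data; the dynamical predicates are abstract fields) -/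

/-- Schematic data of Theorem 2.1 over a perturbation space `Pot` (the potentials `Cʳ(𝕋²,ℝ)`, `r ≥ 4`): an energy
interval `[E_a, E_d]` above `min α`, and two abstract predicates — "the Mather set `𝓜̃(E,g)` of `L + P`
consists of hyperbolic periodic orbits" and "it consists of exactly one periodic orbit" (the homology class
`g` is fixed and suppressed). [cite: ChengZhou2016, Theorem 2.1 p0004:L22–23] -/
structure Theorem21Data (Pot : Type*) where
  /-- endpoints of the energy interval -/
  Ea : ℝ
  Ed : ℝ
  /-- `𝓜̃(E,g)` of `L + P` consists of hyperbolic periodic orbits -/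
  matherHypPeriodic : Pot → ℝ → Prop
  /-- `𝓜̃(E,g)` of `L + P` is exactly one periodic orbit -/
  matherSingleOrbit : Pot → ℝ → Prop

/-- The "good" predicate of Theorem 2.1 for one potential: hyperbolic periodic Mather sets at every energy of
the interval, a single orbit except at finitely many energies. [cite: ChengZhou2016, Theorem 2.1 p0004:L22–23] -/
def Theorem21Data.Good {Pot : Type*} (D : Theorem21Data Pot) (P : Pot) : Prop :=
  (∀ E ∈ Icc D.Ea D.Ed, D.matherHypPeriodic P E) ∧
    {E | E ∈ Icc D.Ea D.Ed ∧ ¬ D.matherSingleOrbit P E}.Finite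

/-- Conclusion shape of Theorem 2.1: open-dense genericity of `Good` in the full potential space.
[cite: ChengZhou2016, Theorem 2.1 p0004:L22–23] -/
def Theorem21Shape {Pot : Type*} [TopologicalSpace Pot] (D : Theorem21Data Pot) : Prop :=
  OpenDenseGood Pot D.Good

/-- The RESTRICTED form of the same conclusion: potentials range over a parameter space `A` through
`ι : A → Pot` (in the use under audit by the cell: `A` = a ball of potentials of an ambient
three-degree-of-freedom system modulo those of a two-degree-of-freedom factor, `ι` = the induced potential of
the system restricted to an invariant cylinder). By `not_openDenseGoodVia_line` / `exists_good_not_via` this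
is NOT a formal consequence of `Theorem21Shape D` unless `ι` is open (`theorem21ShapeVia_of_isOpenMap`).
[cite: ChengZhou2016, Theorem 2.1 p0004:L22–23] -/
def Theorem21ShapeVia {Pot : Type*} (D : Theorem21Data Pot) (A : Type*) [TopologicalSpace A]
    (ι : A → Pot) : Prop :=
  OpenDenseGoodVia A Pot ι D.Good

/-- Transfer of the Theorem 2.1 shape along a continuous open map of perturbation spaces. [folklore] -/
theorem theorem21ShapeVia_of_isOpenMap {Pot : Type*} [TopologicalSpace Pot] (D : Theorem21Data Pot)
    {A : Type*} [TopologicalSpace A] {ι : A → Pot} (hc : Continuous ι) (ho : IsOpenMap ι)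
    (h : Theorem21Shape D) : Theorem21ShapeVia D A ι :=
  openDenseGoodVia_of_isOpenMap hc ho h

/-- Schematic data of Theorem 3.1 over a perturbation space `Pot` (`Cʳ(M,ℝ)`, `M = 𝕋²`, `r ≥ 4`): parametric
non-degeneracy of the minimizers of the action function `F(·,E)` on the section, simultaneously for `E` near `E₀`. [cite: ChengZhou2016, Theorem 3.1 p0008:L55–56] -/
structure Theorem31Data (Pot : Type*) where
  /-- centre and radius of the energy window -/
  E0 : ℝ
  δ : ℝ
  /-- the action function `F_P(x,E)` on the section `𝕋 ∋ x` -/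
  F : Pot → ℝ → ℝ → ℝ
  /-- "`x` is a non-degenerate minimizer of `F_P(·,E)`" -/
  nondegMin : Pot → ℝ → ℝ → Prop

/-- Conclusion shape of Theorem 3.1: for an open-dense set of potentials, every global minimizer of
`F_P(·,E)` is non-degenerate for every `E` in the window. [cite: ChengZhou2016, Theorem 3.1 p0008:L55–56] -/
def Theorem31Shape {Pot : Type*} [TopologicalSpace Pot] (D : Theorem31Data Pot) : Prop :=
  OpenDenseGood Pot fun P =>
    ∀ E ∈ Icc (D.E0 - D.δ) (D.E0 + D.δ), ∀ x, IsMinOn (D.F P E) Set.univ x → D.nondegMin P E x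

end Literature.Dynamics.Hamiltonian.ChengZhou2016
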